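import Mathlib
import Literature.Analysis.FluidPDE.Tao2016AveragedNS.ShiftSetCascadeFlows
import Literature.Analysis.FluidPDE.Tao2016AveragedNS.ShiftSetCascadeFlux
import Summits.NavierStokesRegularity.NavierStokesRegularity.Theorems.TaoLadderRungTwoFlatCertificateGlueChecksOn
import Summits.NavierStokesRegularity.NavierStokesRegularity.Theorems.TaoLadderRungTwoFlatCertificateGlueMeshOn
import HarnessLib

/-!
# Certificate glue on a shift set `𝕊`, XII: THE REGISTERED STUB `stub_rung_quarter` FROM DATA, NINE SCALAR CHECKS,
  THE STATIC CLAUSE `hinside` AND A MESH CERTIFICATE (helper for item stmt-NavierStokesRegularity-22987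
  `FlatGapCertificatesV2`, crux K_A♭ of route TaoLadderRungTwoFlat; cell harvest/h2-tao-ladder, p1 g14)

`stub_rung_quarter_of_meshChecks` = glue IX (`stub_rung_quarter_of_checks`, p604162) with its two dynamical clauses
`htrap` / `hland` — which quantify over ALL exact window trajectories with arbitrary continuous admissible edge inputs —
DISCHARGED by the mesh layer (glue X, `htrap_of_mesh` / `hland_of_mesh`, p607284). What the numerics side must now
deliver for the ε₀ = 1/4 rung of the flat line is FINITE IN SHAPE: a time mesh `0 = t 0 < … < t N` with `c ≤ t N`, node
and hull predicates (boxes) with the fattened core inside `Node 0`, ONE-STEP ENCLOSURES `StepCert j` (every window run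
of length ≤ the step from `Node j`, a priori in the closed `M`-box, stays in `Hull j` and ends in `Node (j+1)`; e.g. by
the first-order Picard test of glue XI, or by a Taylor model with restart), hulls inside the open `M`-box, a landing
step `ℓ` (`t (ℓ+1) ≤ c₀`) where a section functional continuous along runs (e.g. the observable modulus `|y 0 1|`,
`continuousOn_abs_obs`) passes from `< lev` on `Node ℓ` to `≥ lev` on `Node (ℓ+1)`, and the STATIC readout clauses on
`Hull ℓ ∩ {sec = lev}` (ratio `a ≥ (5/4)^{-θ₀}` with slack, matching core state within `ρ r`, top acceptance, bottom
exit) — plus the data, the nine scalar checks and `hinside` of glue IX.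

HONEST FRAMING: Tao-type MODEL lattice; every hypothesis is a HYPOTHESIS — no certificate instance exists in the tree,
nothing is certified here and no stub is closed by this file; nothing here is a statement about the Navier–Stokes
equations.
-/

noncomputable section

-- the sub-problem namespace repeats the summit name by design (D-0017)
set_option linter.dupNamespace false

namespace Summit.NavierStokesRegularity.NavierStokesRegularity.Theorems

open Set Filter Topology MeasureTheory intervalIntegral Literature.Analysis.FluidPDE
  Literature.Analysis.FluidPDE.TaoCascade
open Summit.NavierStokesRegularity.NavierStokesRegularity.Theorems.GappedFrontRobustOn

namespace CertificateGlueOn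

/-- **THE REGISTERED STUB `stub_rung_quarter` FROM DATA, NINE SCALAR CHECKS, `hinside` AND A MESH CERTIFICATE**
(see the module docstring; glue IX with `htrap` / `hland` discharged by glue X).
[cite: Tao2016AveragedNS, §6.3–6.4 Props. 6.4–6.5 (statement shape of a renormalisation certificate); route TaoLadderRungTwoFlat, crux K_A♭, stub_rung_quarter] -/
theorem stub_rung_quarter_of_meshChecks {X₀ : Fin 2 → ℝ} (hX₀ : X₀ 0 ≠ 0)
    -- window, weights, radius, contraction, exponents, clocks, slack
    {Kb Ka : ℤ} (hKb : 0 ≤ Kb) (hKa : 4 ≤ Ka) {Core : (Fin 2 → ℤ → ℝ) → Prop} {M w : ℤ → ℝ}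
    {r ρ θ₀ θ c₀ c σ : ℝ} (hr : 0 < r) (hρ : 0 ≤ ρ) (hρ1 : ρ < 1) (hθ₀ : 0 ≤ θ₀) (hθ₀θ : θ₀ < θ)
    (hθ : θ ≤ 1 / 2) (hc₀ : 0 < c₀) (hc₀c : c₀ < c) (hσ : 0 < σ)
    {Mmax : ℝ} (hMmax : ∀ k, -Kb ≤ k → k ≤ Ka → M k ≤ Mmax)
    (hcore : ∀ z z' : Fin 2 → ℤ → ℝ, (∀ i k, -Kb ≤ k → k ≤ Ka → z i k = z' i k) → Core z → Core z')
    (hdatum : Core (datumState (0 : Fin 2) X₀))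
    -- the piecewise-Gaussian weight
    {Cw b : ℝ} (hCw : 1 ≤ Cw) (hb : 1 / 2 ≤ b)
    (hwp : ∀ k : ℤ, 0 ≤ k → w k = Cw * (2 : ℝ) ^ ((k : ℝ) ^ 2 / 2 + b * k))
    (hwn : ∀ k : ℤ, k < 0 → w k = Cw)
    -- wake side: geometric reference envelope and its two scalar checks
    {Zb Zf : ℤ → ℝ} {Cb γ : ℝ} (hCb : 0 < Cb) (hγ0 : 0 ≤ γ) (hγ1 : γ ≤ 1)
    (hZb : ∀ j : ℤ, Zb j = Cb * (1 + (1 / 4 : ℝ)) ^ (-(γ * j)))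
    (hZf : ∀ j : ℤ, Zf j = 2 * (Zb j + r / Cw)) (hMZf : M (-Kb) ≤ Zf (-Kb))
    (checkB₁ : 32 * c * 28 * (1 + (1 / 4 : ℝ)) ^ (2 * γ) *
      ((1 + (1 / 4 : ℝ)) ^ ((5 : ℝ) * ((-Kb - 1 : ℤ) : ℝ) / 2) * (Zb (-Kb - 1) + r / Cw)) ≤ 1)
    (checkB₂ : (1 + (1 / 4 : ℝ)) ^ θ₀ * (Zb (-Kb - 1) + r / Cw +
      32 * c * 28 * (1 + (1 / 4 : ℝ)) ^ (2 * γ) *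
        ((1 + (1 / 4 : ℝ)) ^ ((5 : ℝ) * ((-Kb - 1 : ℤ) : ℝ) / 2) * (Zb (-Kb - 1) + r / Cw) ^ 2)) ≤ Zb (-Kb - 1 - 1))
    -- quiet side: two-level profile and its scalar checks
    {ν : ℤ → ℝ} {ν₀ ν₁ ϑ : ℝ} (hcoreTop : ∀ z, Core z → ∀ i, 4 * (w Ka * |z i Ka|) ≤ r)
    (hνKa : ν Ka = ν₀) (hνhi : ∀ K : ℤ, Ka + 1 ≤ K → ν K = ν₁) (hν₀ : 0 ≤ ν₀) (hν₁ : 0 ≤ ν₁)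
    (hMν : M Ka ≤ ν₀ * r / w (Ka - 1))
    (checkA₁ : (1 + (1 / 4 : ℝ)) ^ ((5 : ℝ) * ((Ka + 1 : ℤ) : ℝ) / 2) * r * w (Ka + 1 - 1) ≤ ϑ * w (Ka + 1 - 2) ^ 2)
    (checkA₂ : (1 + (1 / 4 : ℝ)) ^ ((5 : ℝ) * ((Ka : ℤ) : ℝ) / 2) *
      coeffAbsOn (botShifts shiftSetFlat) (mirrorTable (1 / 2) (1 / 2)) * c * (ν₀ * r / w (Ka - 1)) ≤ 1 / 2)
    (checkA₃ : (1 + (1 / 4 : ℝ)) ^ ((5 : ℝ) * ((Ka + 1 : ℤ) : ℝ) / 2) *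
      coeffAbsOn (botShifts shiftSetFlat) (mirrorTable (1 / 2) (1 / 2)) * c * (ν₁ * r / w Ka) ≤ 1 / 2)
    (checkA₄ : 2 * (Real.sqrt 2 * Real.sqrt (4 / 3 * (2 : ℕ) * (25 / 32)) / (2 * (1 + (1 / 4 : ℝ)) ^ ((Ka : ℤ) : ℝ)) +
      coeffAbsOn (botShifts shiftSetFlat) (mirrorTable (1 / 2) (1 / 2)) * c *
        (ϑ / (1 + (1 / 4 : ℝ)) ^ ((5 : ℝ) / 2)) * ν₀ ^ 2) ≤ ν₁)
    (checkA₅ : 2 * (Real.sqrt 2 * Real.sqrt (4 / 3 * (2 : ℕ) * (25 / 32)) / (2 * (1 + (1 / 4 : ℝ)) ^ ((Ka + 1 : ℤ) : ℝ)) +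
      coeffAbsOn (botShifts shiftSetFlat) (mirrorTable (1 / 2) (1 / 2)) * c *
        (ϑ / (1 + (1 / 4 : ℝ)) ^ ((5 : ℝ) / 2)) * ν₁ ^ 2) ≤ ν₁)
    (checkA₆ : ν₁ * (1 + (1 / 4 : ℝ)) ^ θ₀ ≤ ρ)
    -- the certificate's interior, trapping and landing clauses
    (hinside : ∀ (z S₀ : Fin 2 → ℤ → ℝ), Core z →
      (∀ i k, -Kb ≤ k → k ≤ Ka → w k * |S₀ i k - z i k| ≤ r) → ∀ i k, -Kb ≤ k → k ≤ Ka → |S₀ i k| < M k)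
    -- the MESH CERTIFICATE replacing `htrap` / `hland` (glue X): mesh, node/hull predicates, start, steps,
    -- hulls inside the open `M`-box, section crossing in step `ℓ`, static readout on `Hull ℓ ∩ {sec = lev}`
    {t : ℕ → ℝ} {N ℓ : ℕ} {Node Hull : ℕ → (Fin 2 → ℤ → ℝ) → Prop} {sec : (Fin 2 → ℤ → ℝ) → ℝ} {lev : ℝ}
    (ht0 : t 0 = 0) (hmono : ∀ j, j < N → t j < t (j + 1)) (hcN : c ≤ t N) (hℓN : ℓ + 1 ≤ N)
    (hℓc₀ : t (ℓ + 1) ≤ c₀)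
    (hstart : ∀ (z S₀ : Fin 2 → ℤ → ℝ), Core z →
      (∀ i k, -Kb ≤ k → k ≤ Ka → w k * |S₀ i k - z i k| ≤ r) → Node 0 S₀)
    (hstep : ∀ j, j < N → StepCert shiftSetFlat (1 / 4) (mirrorTable (1 / 2) (1 / 2)) Kb Ka (Zf (-Kb - 1))
      (ν (Ka + 1) * r / w Ka) M t Node Hull j)
    (hhull : ∀ j, j < N → ∀ y, Hull j y → ∀ i k, -Kb ≤ k → k ≤ Ka → |y i k| < M k)
    (hsec : ∀ (s : ℝ) (S : Fin 2 → ℤ → ℝ → ℝ), WindowRun shiftSetFlat (1 / 4) (mirrorTable (1 / 2) (1 / 2)) Kb Ka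
      (Zf (-Kb - 1)) (ν (Ka + 1) * r / w Ka) s S → ContinuousOn (fun u => sec (slice S u)) (Icc 0 s))
    (hbefore : ∀ y, Node ℓ y → sec y < lev) (hafter : ∀ y, Node (ℓ + 1) y → lev ≤ sec y)
    (hread : ∀ y, Hull ℓ y → sec y = lev →
      ∃ (a : ℝ) (z' : Fin 2 → ℤ → ℝ), 0 < a ∧ (1 + (1 / 4 : ℝ)) ^ (-θ₀) ≤ a ∧ (1 + σ) * a ≤ |y 0 1| ∧ Core z' ∧
        (∀ i k, -Kb ≤ k → k + 1 ≤ Ka → w k * |y i (1 + k) / a - z' i k| ≤ ρ * r) ∧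
        (∀ (i : Fin 2) (v : ℝ), |v| ≤ ν (Ka + 1) * r / w Ka → w Ka * |v / a - z' i Ka| ≤ ρ * r) ∧
        (∀ i, |y i (-Kb)| ≤ a * Zb (-Kb - 1))) :
    ∃ (σ : ℝ) (X₀ : Fin 2 → ℝ) (Z : Set (Fin 2 → ℤ → ℝ)) (w : ℤ → ℝ) (r ρ θ₀ θ c₀ c : ℝ) (env₀ : ℤ → ℝ),
      X₀ 0 ≠ 0 ∧
        GapData₂On shiftSetFlat σ (1 / 4) (0 : Fin 2) (mirrorTable (1 / 2) (1 / 2)) X₀ Z w r ρ θ₀ θ c₀ c env₀ ∧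
          TailThin (1 / 4) w r ∧
            ∃ (Cw b : ℝ), 1 ≤ Cw ∧ 1 / 2 ≤ b ∧ ∀ k : ℤ, 0 ≤ k → w k = Cw * (2 : ℝ) ^ ((k : ℝ) ^ 2 / 2 + b * k) :=
  stub_rung_quarter_of_checks hX₀ hKb hKa hr hρ hρ1 hθ₀ hθ₀θ hθ hc₀ hc₀c hσ hMmax hcore hdatum hCw hb hwp hwn hCb hγ0 hγ1 hZb hZf hMZf checkB₁ checkB₂ hcoreTop hνKa hνhi hν₀ hν₁ hMν checkA₁ checkA₂ checkA₃ checkA₄ checkA₅ checkA₆ hinside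
    (htrap_of_mesh ht0 hmono hcN hstart hstep hhull)
    (hland_of_mesh (Node := Node) (Hull := Hull) ht0 (fun j hj => hmono j (by omega)) hℓc₀ hstart
      (fun j hj => hstep j (by omega)) hsec hbefore hafter hread)

end CertificateGlueOn

end Summit.NavierStokesRegularity.NavierStokesRegularity.Theorems

end
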